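import Summits.BirchSwinnertonDyer.BirchSwinnertonDyer.Theorems.ClassRecordThreeRegCertKernelDeep
import Summits.BirchSwinnertonDyer.BirchSwinnertonDyer.Theorems.ClassRecordThreeRegCertKernelO2Log
import Summits.BirchSwinnertonDyer.BirchSwinnertonDyer.Theorems.ClassRecordThreeRegCertKernelO2Aux
import HarnessLib

/-!
# Route `ClassRecordThree`, crux `SchneiderAtThree` (item 19106): the SECOND-ORDER kernel evaluator at a DEEP
# certificate point (`v₃(e(Q)) = K ≥ 2`, `v₃(h(Q)) ≤ 2`) — `h mod 27` from `(a, b, e', a₁)` and one residue `u`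
# (cell `bsd-stepL`, seat `bsd-stepL-reg3-eng` g3; `--supports stmt-BirchSwinnertonDyer-19106`)

HONEST FRAMING: BSD is not proved by any of this; nothing here closes the crux; Schneider's conjecture (barrier
`PAdicHeightNondegeneracy`) is asserted NOWHERE. Second-order twin of `…RegCertKernelDeep`: for `e = 3^K e'`, `K ≥ 2`
(`z = −ae/b`, `‖z‖ = 3⁻ᴷ`), one more term survives — `log_Ŵ(z) ≡ z + a₁z²/2` (§1: `‖log_Ŵ(z) − z − a₁z²/2‖ ≤ 3‖z‖³`
on `‖z‖ ≤ 3⁻²`) — while `ch(w) − 1 ≡ w/2`, `Π ≡ 1` and the scale `C²` still cancel, so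
`C²σ² ≡ z²(1 + a₁z) = 3^{2K}·U`, `U = (ae'/b)²(1 − a₁3ᴷae'/b)` to relative precision `3⁻³`; the Iwasawa logarithms
to three terms (§2) give `h ≡ ½[(E − E²/2 + E³/3) − (V − V²/2 + V³/3)] (mod 27)` with `E = e'⁴ − 1`, `V = u² − 1`,
`27 ∣ (ae')²(b − a₁3ᴷae') − ub³`; CERTIFICATE **`3⁴ ∤ 6E − 3E² + 2E³ − 6V + 3V² − 2V³`** ⇒ `h ≠ 0`
(§3 `heightFourOneCoord_ne_zero_of_deepCertO2`). Validated offline on all 246 deep rows of kit j249075 (`h mod 27`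
reproduced). Theorems only (0 defs, 0 facts). References: [SteinWuthrich2013] §4.2; [SilvermanAEC2009] IV.6;
[Iwasawa1972PadicL] §4.4.
-/

open scoped Classical
open PowerSeries WeierstrassCurve Literature.NumberTheory.EllipticCurves
  Literature.NumberTheory.EllipticCurves.SteinWuthrich2013
  Summit.BirchSwinnertonDyer.Rank1Residual.X11b.RegMult.Rung62310y1

namespace Summit.BirchSwinnertonDyer.Rank1Residual.X11b.RegMult.KernelCert

/-! ### §0 Plumbing -/

/-- Ultrametric inequality for differences. [folklore] -/
private theorem norm_sub_le_max₄ (a b : ℚ_[3]) : ‖a - b‖ ≤ max ‖a‖ ‖b‖ := by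
  rw [sub_eq_add_neg, ← norm_neg b]; exact IsUltrametricDist.norm_add_le_max a (-b)

/-- `‖(2 : ℚ₃)⁻¹‖ = 1`. [folklore] -/
private theorem norm_inv_two₄ : ‖(2 : ℚ_[3])⁻¹‖ = 1 := by
  rw [norm_inv, show (2 : ℚ_[3]) = ((2 : ℤ) : ℚ_[3]) by norm_cast, norm_intCast_eq_one_of_not_dvd (by decide),
    inv_one]

/-- `‖(3 : ℚ₃)⁻¹‖ = 3`. [folklore] -/
private theorem norm_inv_three₄ : ‖(3 : ℚ_[3])⁻¹‖ = 3 := by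
  rw [norm_inv, show (3 : ℚ_[3]) = ((3 : ℕ) : ℚ_[3]) by norm_cast, Padic.norm_p]; norm_num

/-- `n + 4 ≤ 3·9^{n+1}`. [folklore] -/
private theorem add_four_le (n : ℕ) : n + 4 ≤ 3 * 9 ^ (n + 1) := by
  induction n with
  | zero => norm_num
  | succ k ih => have h : 9 ^ (k + 1 + 1) = 9 * 9 ^ (k + 1) := by ring
                 omega

/-! ### §1 The formal logarithm to second order -/

section Padic

variable (V : WeierstrassCurve ℚ_[3]) [V.IsIntegral ℤ_[3]]

/-- Each term of degree `n + 3` of `log_Ŵ(z)` has norm `≤ 3‖z‖³` for `‖z‖₃ ≤ 3⁻²`. [cite: SilvermanAEC2009, IV.6.3] -/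
private theorem norm_formalLog_term_le_cube {z : ℚ_[3]} (hz : ‖z‖ ≤ 1 / 9) (n : ℕ) :
    ‖coeff (n + 3) V.formalLog * z ^ (n + 3)‖ ≤ 3 * ‖z‖ ^ 3 := by
  rw [norm_mul, norm_pow]
  have hc := norm_coeff_formalLog_le_norm_inv V (n + 1)
  rw [show n + 1 + 2 = n + 3 by ring] at hc
  have hz0 : 0 ≤ ‖z‖ := norm_nonneg z
  cases n with
  | zero =>
    have h3 : ‖(((0 + 3 : ℕ) : ℚ_[3]))⁻¹‖ = 3 := by
      rw [show ((0 + 3 : ℕ) : ℚ_[3]) = ((3 : ℕ) : ℚ_[3]) by norm_num, norm_inv, Padic.norm_p]; norm_num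
    calc ‖coeff (0 + 3) V.formalLog‖ * ‖z‖ ^ (0 + 3) ≤ 3 * ‖z‖ ^ (0 + 3) := by gcongr; exact hc.trans h3.le
      _ = 3 * ‖z‖ ^ 3 := by ring
  | succ k =>
    have hm : ‖(((k + 1 + 3 : ℕ) : ℚ_[3]))⁻¹‖ ≤ ((k + 1 + 3 : ℕ) : ℝ) := padic_norm_inv_natCast_le _
    have hpow : ((k + 1 + 3 : ℕ) : ℝ) ≤ 3 * (9 : ℝ) ^ (k + 1) := by
      have h := add_four_le k
      rw [show k + 1 + 3 = k + 4 by ring]; exact_mod_cast h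
    calc ‖coeff (k + 1 + 3) V.formalLog‖ * ‖z‖ ^ (k + 1 + 3)
        ≤ (3 * (9 : ℝ) ^ (k + 1)) * ‖z‖ ^ (k + 1 + 3) := by gcongr; exact hc.trans (hm.trans hpow)
      _ = 3 * ‖z‖ ^ 3 * ((9 : ℝ) ^ (k + 1) * ‖z‖ ^ (k + 1)) := by ring
      _ ≤ 3 * ‖z‖ ^ 3 * ((9 : ℝ) ^ (k + 1) * (1 / 9 : ℝ) ^ (k + 1)) := by gcongr
      _ = 3 * ‖z‖ ^ 3 := by rw [← mul_pow]; norm_num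

/-- **`log_Ŵ(z) = z + (a₁/2)z² + O(3‖z‖³)` on `‖z‖₃ ≤ 3⁻²`** for a `3`-integral equation over `ℚ₃`.
[cite: SilvermanAEC2009, IV.6.4] -/
theorem norm_padicFormalLog_sub_quad_le {z : ℚ_[3]} (hz : ‖z‖ ≤ 1 / 9) :
    ‖V.padicFormalLog z - (z + (2 : ℚ_[3])⁻¹ * V.a₁ * z ^ 2)‖ ≤ 3 * ‖z‖ ^ 3 := by
  have hs := V.summable_formalLog_of_isIntegral z (hz.trans_lt (by norm_num))
  have hsplit := hs.sum_add_tsum_nat_add 3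
  have h0 : coeff 0 V.formalLog = 0 := by rw [coeff_zero_eq_constantCoeff]; exact V.constantCoeff_formalLog
  have h2 : coeff 2 V.formalLog = (2 : ℚ_[3])⁻¹ * V.a₁ := by
    rw [(coeff_two_formalLog V), eq_ratCast]; push_cast; ring
  have hthree : ∑ i ∈ Finset.range 3, coeff i V.formalLog * z ^ i = z + (2 : ℚ_[3])⁻¹ * V.a₁ * z ^ 2 := by
    simp only [Finset.sum_range_succ, Finset.sum_range_zero, h0, V.coeff_one_formalLog, h2]; ring
  rw [WeierstrassCurve.padicFormalLog, ← hsplit, hthree, add_sub_cancel_left]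
  exact IsUltrametricDist.norm_tsum_le_of_forall_le_of_nonneg (by positivity) fun n ↦
    norm_formalLog_term_le_cube V hz n

end Padic

/-! ### §2 The Iwasawa logarithm at valuation `2K` to second order -/

/-- **`‖Y − 3^{2K}U‖ ≤ 3^{−2K−3}`, `‖U‖ = 1`, `‖U² − 1‖ ≤ 3⁻¹ ⇒ ‖log₃ Y − ½(V − V²/2 + V³/3)‖ ≤ 3⁻³`, `V = U² − 1`**
(`t = Y·3^{−2K}`, `‖t − U‖ ≤ 3⁻³`; `L(t²) = −T − T²/2 − T³/3 + O(‖T‖⁴)`, `T = 1 − t²`; §O2Log and the `1`-Lipschitz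
cubic). [cite: Iwasawa1972PadicL, §4.4] -/
theorem norm_padicLog_sub_le_deepO2 {Y U : ℚ_[3]} (K : ℕ) (hU : ‖U‖ = 1) (hU2 : ‖U ^ 2 - 1‖ ≤ 1 / 3)
    (hY : ‖Y - (3 : ℚ_[3]) ^ (2 * K) * U‖ ≤ ‖(3 : ℚ_[3]) ^ (2 * K)‖ / 27) :
    ‖padicLog 3 Y - (2 : ℚ_[3])⁻¹ * ((U ^ 2 - 1) - (U ^ 2 - 1) ^ 2 / 2 + (U ^ 2 - 1) ^ 3 / 3)‖ ≤ 1 / 27 := by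
  set P : ℚ_[3] := (3 : ℚ_[3]) ^ (2 * K) with hP
  have hPn : ‖P‖ = ((3 : ℝ) ^ (2 * K))⁻¹ := by
    rw [hP, norm_pow, show (3 : ℚ_[3]) = ((3 : ℕ) : ℚ_[3]) by norm_cast, Padic.norm_p]; simp
  have hPpos : 0 < ‖P‖ := by rw [hPn]; positivity
  have hPU : ‖P * U‖ = ‖P‖ := by rw [norm_mul, hU, mul_one]
  have hYn : ‖Y‖ = ‖P‖ := by
    rw [← hPU]; refine Padic.norm_eq_of_norm_sub_lt_right (hY.trans_lt ?_); rw [hPU]; linarith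
  have hY0 : Y ≠ 0 := by intro h; rw [h, norm_zero] at hYn; exact hPpos.ne hYn
  have hv : Y.valuation = ((2 * K : ℕ) : ℤ) := by
    refine valuation_eq_of_norm_eq hY0 ?_
    rw [hYn, hPn, zpow_neg, zpow_natCast]; norm_num
  have hlog : padicLog 3 Y = (2 : ℚ_[3])⁻¹ * padicLogSeries 3 ((Y * (3 : ℚ_[3]) ^ (-((2 * K : ℕ) : ℤ))) ^ 2) := by
    rw [padicLog_of_ne_zero hY0, hv]; push_cast; rw [show ((3 : ℚ_[3]) - 1) = 2 by norm_num]
  rw [hlog]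
  set t : ℚ_[3] := Y * (3 : ℚ_[3]) ^ (-((2 * K : ℕ) : ℤ)) with ht
  have hP0 : P ≠ 0 := norm_pos_iff.mp hPpos
  have hinv : (3 : ℚ_[3]) ^ (-((2 * K : ℕ) : ℤ)) = P⁻¹ := by rw [zpow_neg, zpow_natCast]
  have htu : t - U = (Y - P * U) * P⁻¹ := by rw [ht, hinv]; field_simp
  have htun : ‖t - U‖ ≤ 1 / 27 := by
    rw [htu, norm_mul, norm_inv]
    calc ‖Y - P * U‖ * ‖P‖⁻¹ ≤ ‖P‖ / 27 * ‖P‖⁻¹ := by gcongr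
      _ = 1 / 27 := by field_simp
  have htu1 : ‖t + U‖ ≤ 1 := by
    rw [show t + U = (t - U) + 2 * U by ring]
    refine (IsUltrametricDist.norm_add_le_max _ _).trans (max_le (htun.trans (by norm_num)) ?_)
    rw [norm_mul, hU, mul_one, show (2 : ℚ_[3]) = ((2 : ℤ) : ℚ_[3]) by norm_cast]; exact Padic.norm_int_le_one _
  set T : ℚ_[3] := 1 - t ^ 2 with hT
  set T0 : ℚ_[3] := 1 - U ^ 2 with hT0
  have hTT0 : ‖T - T0‖ ≤ 1 / 27 := by
    rw [show T - T0 = -((t - U) * (t + U)) by rw [hT, hT0]; ring, norm_neg, norm_mul]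
    calc ‖t - U‖ * ‖t + U‖ ≤ 1 / 27 * 1 := by gcongr
      _ = 1 / 27 := mul_one _
  have hT0n : ‖T0‖ ≤ 1 / 3 := by rw [hT0, ← norm_neg, neg_sub]; exact hU2
  have hTn : ‖T‖ ≤ 1 / 3 := by
    rw [show T = (T - T0) + T0 by ring]; exact (IsUltrametricDist.norm_add_le_max _ _).trans (max_le (hTT0.trans (by norm_num)) hT0n)
  have hL := norm_padicLogSeries_add_cubic_le (y := t ^ 2) (by rw [← hT]; exact hTn)
  rw [← hT] at hL
  have hP3 := norm_cubicPoly_sub_le hTn hT0n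
  have hU' : U ^ 2 - 1 = -T0 := by rw [hT0]; ring
  rw [hU']
  have hsplit : (2 : ℚ_[3])⁻¹ * padicLogSeries 3 (t ^ 2) - (2 : ℚ_[3])⁻¹ * (-T0 - (-T0) ^ 2 / 2 + (-T0) ^ 3 / 3) =
      (2 : ℚ_[3])⁻¹ * ((padicLogSeries 3 (t ^ 2) + (T + T ^ 2 / 2 + T ^ 3 / 3)) -
        ((T + T ^ 2 / 2 + T ^ 3 / 3) - (T0 + T0 ^ 2 / 2 + T0 ^ 3 / 3))) := by ring
  rw [hsplit, norm_mul, norm_inv_two₄, one_mul]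
  refine (norm_sub_le_max₄ _ _).trans (max_le (hL.trans ?_) (hP3.trans hTT0))
  calc ‖T‖ ^ 4 ≤ (1 / 3) ^ 4 := by gcongr
    _ ≤ 1 / 27 := by norm_num

/-! ### §3 Assembly at depth `K ≥ 2`, second order -/

/-- **The second-order DEEP REG3CERT kernel certificate (`v₃(e(Q)) = K ≥ 2`, `v₃(h(Q)) ≤ 2`).** `W/ℚ` globally minimal,
`a₁, c₄, c₆` read in `ℚ₃`, `3 ∤ c₆`, `9 ∣ c₄ + γc₆`, `3 ∤ γ`; `(x, y) = (a/e², b/e³)`, `e = 3^K e'`, `K ≥ 2`, `3 ∤ e'`,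
`3 ∤ b`, `gcd(a, e) = 1`; an integer `u` with `27 ∣ (ae')²(b − a₁3ᴷae') − ub³`, `3 ∤ u` (`3 ∣ u² − 1`). If
**`3⁴ ∤ 6E − 3E² + 2E³ − 6V + 3V² − 2V³`** (`E = e'⁴ − 1`, `V = u² − 1`), then `heightFourOneCoord W 3 q x y ≠ 0` for
EVERY `‖q‖₃ < 1`: `C²σ² ≡ log_Ŵ(z)² ≡ z²(1 + a₁z) = 3^{2K}(ae'/b)²(1 + a₁z)` to relative precision `3⁻³` (§1; `C²`
cancels), and the two Iwasawa logarithms to three terms (§2). [cite: SteinWuthrich2013, §4.2] [cite: Iwasawa1972PadicL, §4.4] -/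
theorem heightFourOneCoord_ne_zero_of_deepCertO2 (W : WeierstrassCurve ℚ) [W.IsGloballyMinimal]
    {a₁ c4 c6 γ : ℤ} (ha1 : (W.baseChange ℚ_[3]).a₁ = a₁) (hc4 : (W.baseChange ℚ_[3]).c₄ = c4)
    (hc6 : (W.baseChange ℚ_[3]).c₆ = c6) (h3c6 : ¬ (3 : ℤ) ∣ c6) (hγ : (9 : ℤ) ∣ c4 + γ * c6) (h3γ : ¬ (3 : ℤ) ∣ γ)
    {a b : ℤ} {e' K : ℕ} (hK : 2 ≤ K) (h3e' : ¬ (3 : ℤ) ∣ e') (h3b : ¬ (3 : ℤ) ∣ b)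
    (hcop : Nat.Coprime a.natAbs (3 ^ K * e'))
    {x y : ℚ} (hx : x = a / ((3 ^ K * e' : ℕ) : ℚ) ^ 2) (hy : y = b / ((3 ^ K * e' : ℕ) : ℚ) ^ 3)
    {u : ℤ} (hu : (27 : ℤ) ∣ (a * e') ^ 2 * (b - a₁ * 3 ^ K * a * e') - u * b ^ 3) (h3u : ¬ (3 : ℤ) ∣ u)
    (h3u2 : (3 : ℤ) ∣ u ^ 2 - 1)
    (hcert : ¬ (81 : ℤ) ∣ 6 * ((e' : ℤ) ^ 4 - 1) - 3 * ((e' : ℤ) ^ 4 - 1) ^ 2 + 2 * ((e' : ℤ) ^ 4 - 1) ^ 3 -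
      6 * (u ^ 2 - 1) + 3 * (u ^ 2 - 1) ^ 2 - 2 * (u ^ 2 - 1) ^ 3) {q : ℚ_[3]} (hq : ‖q‖ < 1) :
    heightFourOneCoord W 3 q x y ≠ 0 := by
  have hq3 : ‖q‖ ≤ 1 / 3 := norm_le_third_of_norm_lt_one hq
  have he'0 : e' ≠ 0 := by rintro rfl; exact h3e' (by simp)
  have he0 : (3 ^ K * e' : ℕ) ≠ 0 := by positivity
  have hb0 : b ≠ 0 := by rintro rfl; exact h3b (dvd_zero 3)
  have h3a : ¬ (3 : ℤ) ∣ a := by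
    intro h
    have h1 : 3 ∣ a.natAbs := Int.natCast_dvd.mp h
    have h3 : 3 ∣ Nat.gcd a.natAbs (3 ^ K * e') := Nat.dvd_gcd h1 (dvd_mul_of_dvd_left (dvd_pow_self 3 (by omega)) e')
    rw [hcop] at h3; omega
  have han : ‖(a : ℚ_[3])‖ = 1 := norm_intCast_eq_one_of_not_dvd h3a
  have hbn : ‖(b : ℚ_[3])‖ = 1 := norm_intCast_eq_one_of_not_dvd h3b
  have he'n : ‖(e' : ℚ_[3])‖ = 1 := by
    have := norm_intCast_eq_one_of_not_dvd h3e'; push_cast at this; exact this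
  have ha1n : ‖(a₁ : ℚ_[3])‖ ≤ 1 := Padic.norm_int_le_one _
  have hb0' : (b : ℚ_[3]) ≠ 0 := by exact_mod_cast hb0
  set P : ℚ_[3] := (3 : ℚ_[3]) ^ (2 * K) with hP
  have hPn : ‖P‖ = ((1 / 3 : ℝ) ^ K) ^ 2 := by
    rw [hP, norm_pow, show (3 : ℚ_[3]) = ((3 : ℕ) : ℚ_[3]) by norm_cast, Padic.norm_p, mul_comm 2 K, pow_mul]
    norm_num
  set z : ℚ_[3] := -((a : ℚ_[3]) * ((3 ^ K * e' : ℕ) : ℚ_[3])) / (b : ℚ_[3]) with hz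
  set U : ℚ_[3] := ((a : ℚ_[3]) * (e' : ℚ_[3]) / (b : ℚ_[3])) ^ 2 * (1 + (a₁ : ℚ_[3]) * z) with hU
  have hz2 : z ^ 2 * (1 + (a₁ : ℚ_[3]) * z) = P * U := by rw [hU, hz, hP]; push_cast; field_simp; ring
  have hρ : ‖z‖ = (1 / 3 : ℝ) ^ K := by
    rw [hz, norm_div, norm_neg, norm_mul, han, hbn, one_mul, div_one]
    push_cast
    rw [norm_mul, norm_pow, he'n, mul_one, show (3 : ℚ_[3]) = ((3 : ℕ) : ℚ_[3]) by norm_cast, Padic.norm_p]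
    norm_num
  set ρ : ℝ := ‖z‖ with hρdef
  have hρ9 : ρ ≤ 1 / 9 := by
    rw [hρ]; calc (1 / 3 : ℝ) ^ K ≤ (1 / 3) ^ 2 := pow_le_pow_of_le_one (by norm_num) (by norm_num) hK
      _ = 1 / 9 := by norm_num
  have hρpos : 0 < ρ := by rw [hρ]; positivity
  have hρ2 : ρ ^ 2 = ‖P‖ := by rw [hρ, hPn]
  have hρ2le : ρ ^ 2 ≤ 1 / 81 := by
    calc ρ ^ 2 ≤ (1 / 9) ^ 2 := by gcongr
      _ = 1 / 81 := by norm_num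
  have hρ2pos : 0 < ρ ^ 2 := by positivity
  have hρ4 : ρ ^ 2 * ρ ^ 2 ≤ ρ ^ 2 * (1 / 81) := mul_le_mul_of_nonneg_left hρ2le (sq_nonneg ρ)
  have hρ3 : ρ ^ 2 * ρ ≤ ρ ^ 2 * (1 / 9) := mul_le_mul_of_nonneg_left hρ9 (sq_nonneg ρ)
  -- `‖1 + a₁z‖ = 1`, `‖U‖ = 1`
  have ha1z : ‖(a₁ : ℚ_[3]) * z‖ ≤ ρ := by
    rw [norm_mul]; calc ‖(a₁ : ℚ_[3])‖ * ‖z‖ ≤ 1 * ρ := by gcongr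
      _ = ρ := one_mul _
  have h1z : ‖1 + (a₁ : ℚ_[3]) * z‖ = 1 := by
    rw [← norm_one (α := ℚ_[3])]
    refine Padic.norm_eq_of_norm_sub_lt_right ?_
    rw [add_sub_cancel_left, norm_one]; exact ha1z.trans_lt (hρ9.trans_lt (by norm_num))
  have hUn : ‖U‖ = 1 := by rw [hU, norm_mul, norm_pow, norm_div, norm_mul, han, he'n, hbn, h1z]; norm_num
  -- §1: `L ≡ M := z + a₁z²/2`
  set V := W.baseChange ℚ_[3] with hV
  set L := V.padicFormalLog z with hLdef
  have hLM : ‖L - (z + (2 : ℚ_[3])⁻¹ * a₁ * z ^ 2)‖ ≤ 3 * ρ ^ 3 := by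
    have := norm_padicFormalLog_sub_quad_le V hρ9; rwa [ha1] at this
  have hMz : ‖(2 : ℚ_[3])⁻¹ * (a₁ : ℚ_[3]) * z ^ 2‖ ≤ ρ ^ 2 := by
    rw [norm_mul, norm_mul, norm_inv_two₄, one_mul, norm_pow]
    calc ‖(a₁ : ℚ_[3])‖ * ρ ^ 2 ≤ 1 * ρ ^ 2 := by gcongr
      _ = ρ ^ 2 := one_mul _
  have hLz : ‖L - z‖ ≤ ρ ^ 2 := by
    rw [show L - z = (L - (z + (2 : ℚ_[3])⁻¹ * a₁ * z ^ 2)) + (2 : ℚ_[3])⁻¹ * a₁ * z ^ 2 by ring]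
    refine (IsUltrametricDist.norm_add_le_max _ _).trans (max_le (hLM.trans ?_) hMz)
    calc 3 * ρ ^ 3 = (3 * ρ) * ρ ^ 2 := by ring
      _ ≤ 1 * ρ ^ 2 := by gcongr; linarith
      _ = ρ ^ 2 := one_mul _
  have hρsq : ρ ^ 2 ≤ ρ * (1 / 9) := by rw [sq]; exact mul_le_mul_of_nonneg_left hρ9 hρpos.le
  have hLn : ‖L‖ = ρ := by
    refine Padic.norm_eq_of_norm_sub_lt_right (hLz.trans_lt ?_)
    show ρ ^ 2 < ρ; linarith
  have hMn : ‖z + (2 : ℚ_[3])⁻¹ * a₁ * z ^ 2‖ ≤ ρ :=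
    (IsUltrametricDist.norm_add_le_max _ _).trans (max_le le_rfl (hMz.trans (by linarith)))
  -- `C²`, `w`, `c − 1 ≡ w/2`, the sigma product
  have hC := norm_uniformisationScaleSq_sub_le W hc4 hc6 h3c6 hγ hq3
  set C2 := uniformisationScaleSq W 3 q with hC2
  have hγn : ‖(γ : ℚ_[3])‖ = 1 := norm_intCast_eq_one_of_not_dvd h3γ
  have hCn : ‖C2‖ = 1 := by
    rw [← hγn]; exact Padic.norm_eq_of_norm_sub_lt_right (hC.trans_lt (by rw [hγn]; norm_num))
  have hC0 : C2 ≠ 0 := by intro h; rw [h, norm_zero] at hCn; exact zero_ne_one hCn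
  have hwdef : logUnitParamSq W 3 q x y = L ^ 2 / C2 := by rw [logUnitParamSq, hx, hy, neg_div_cast_eq hb0 he0]
  set w := L ^ 2 / C2 with hw
  have hwn : ‖w‖ = ρ ^ 2 := by rw [hw, norm_div, norm_pow, hLn, hCn, div_one]
  have hw81 : ‖w‖ ≤ 1 / 81 := by rw [hwn]; exact hρ2le
  have hCw : C2 * w = L ^ 2 := by rw [hw]; field_simp
  set c := coshOfSq w with hc
  have hc1 : ‖(c - 1) - w / 2‖ ≤ 3 * ‖w‖ ^ 2 := by have := norm_coshOfSq_sub_one_sub_half_le hw81; rwa [hc]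
  have h2n : ‖(2 : ℚ_[3])‖ = 1 := by
    rw [show (2 : ℚ_[3]) = ((2 : ℤ) : ℚ_[3]) by norm_cast]; exact norm_intCast_eq_one_of_not_dvd (by decide)
  have hw2 : ‖w / 2‖ = ρ ^ 2 := by rw [norm_div, h2n, div_one, hwn]
  have hc1n : ‖c - 1‖ = ρ ^ 2 := by
    rw [← hw2]; refine Padic.norm_eq_of_norm_sub_lt_right (hc1.trans_lt ?_)
    rw [hw2, hwn, show (ρ ^ 2) ^ 2 = ρ ^ 2 * ρ ^ 2 by ring]; linarith
  have hcn : ‖c‖ ≤ 1 := by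
    rw [show c = (c - 1) + 1 by ring]
    refine (IsUltrametricDist.norm_add_le_max _ _).trans (max_le ?_ (by rw [norm_one])); rw [hc1n]; linarith
  have hPr := norm_tprod_tateSigmaSq_factor_sub_one_le hq hcn
  set Pr := ∏' n : ℕ, (1 - 2 * q ^ (n + 1) * c + q ^ (2 * (n + 1))) ^ 2 / (1 - q ^ (n + 1)) ^ 4 with hPrdef
  have hσ : tateSigmaSq q c = 2 * (c - 1) * Pr := by rw [tateSigmaSq]
  -- `Y = C²σ² ≡ z²(1 + a₁z) = P·U`
  have hY : ‖C2 * tateSigmaSq q c - P * U‖ ≤ ‖P‖ / 27 := by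
    rw [hσ, ← hz2]
    have hsplit : C2 * (2 * (c - 1) * Pr) - z ^ 2 * (1 + (a₁ : ℚ_[3]) * z) =
        2 * C2 * (c - 1) * (Pr - 1) + 2 * C2 * ((c - 1) - w / 2) + (C2 * w - L ^ 2) +
        (L - (z + (2 : ℚ_[3])⁻¹ * a₁ * z ^ 2)) * (L + (z + (2 : ℚ_[3])⁻¹ * a₁ * z ^ 2)) +
        (2 : ℚ_[3])⁻¹ * (2 : ℚ_[3])⁻¹ * (a₁ : ℚ_[3]) ^ 2 * z ^ 4 := by ring
    rw [hsplit, hCw, sub_self, add_zero, ← hρ2]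
    have hb1 : ‖2 * C2 * (c - 1) * (Pr - 1)‖ ≤ ρ ^ 2 / 27 := by
      rw [norm_mul, norm_mul, norm_mul, h2n, hCn, hc1n, one_mul, one_mul]
      calc ρ ^ 2 * ‖Pr - 1‖ ≤ ρ ^ 2 * (‖q‖ * ‖c - 1‖) := by gcongr
        _ ≤ ρ ^ 2 * (1 / 3 * ρ ^ 2) := by rw [hc1n]; gcongr
        _ = (ρ ^ 2 * ρ ^ 2) / 3 := by ring
        _ ≤ (ρ ^ 2 * (1 / 81)) / 3 := by gcongr
        _ ≤ ρ ^ 2 / 27 := by linarith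
    have hb2 : ‖2 * C2 * ((c - 1) - w / 2)‖ ≤ ρ ^ 2 / 27 := by
      rw [norm_mul, norm_mul, h2n, hCn, one_mul, one_mul]
      refine hc1.trans ?_; rw [hwn, show (ρ ^ 2) ^ 2 = ρ ^ 2 * ρ ^ 2 by ring]; linarith
    have hb4 : ‖(L - (z + (2 : ℚ_[3])⁻¹ * a₁ * z ^ 2)) * (L + (z + (2 : ℚ_[3])⁻¹ * a₁ * z ^ 2))‖ ≤ ρ ^ 2 / 27 := by
      rw [norm_mul]
      calc ‖L - (z + (2 : ℚ_[3])⁻¹ * a₁ * z ^ 2)‖ * ‖L + (z + (2 : ℚ_[3])⁻¹ * a₁ * z ^ 2)‖ ≤ 3 * ρ ^ 3 * ρ := by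
            gcongr; exact (IsUltrametricDist.norm_add_le_max _ _).trans (max_le hLn.le hMn)
        _ = 3 * (ρ ^ 2 * ρ ^ 2) := by ring
        _ ≤ 3 * (ρ ^ 2 * (1 / 81)) := by gcongr
        _ = ρ ^ 2 / 27 := by ring
    have hb5 : ‖(2 : ℚ_[3])⁻¹ * (2 : ℚ_[3])⁻¹ * (a₁ : ℚ_[3]) ^ 2 * z ^ 4‖ ≤ ρ ^ 2 / 27 := by
      rw [norm_mul, norm_mul, norm_mul, norm_inv_two₄, norm_pow, norm_pow, one_mul, one_mul]
      calc ‖(a₁ : ℚ_[3])‖ ^ 2 * ρ ^ 4 ≤ 1 ^ 2 * ρ ^ 4 := by gcongr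
        _ = ρ ^ 2 * ρ ^ 2 := by ring
        _ ≤ ρ ^ 2 * (1 / 81) := hρ4
        _ ≤ ρ ^ 2 / 27 := by linarith
    refine (IsUltrametricDist.norm_add_le_max _ _).trans (max_le ?_ hb5)
    refine (IsUltrametricDist.norm_add_le_max _ _).trans (max_le ?_ hb4)
    exact (IsUltrametricDist.norm_add_le_max _ _).trans (max_le hb1 hb2)
  -- `‖U² − 1‖ ≤ 3⁻¹`
  have hdvd : (3 : ℤ) ∣ (a * e') ^ 4 - b ^ 4 := by
    have h1 := three_dvd_pow_four_sub_one (n := a * e') (fun h => by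
      rcases (Int.Prime.dvd_mul' (by norm_num) h) with h | h
      · exact h3a h
      · exact h3e' h)
    rw [show (a * e') ^ 4 - b ^ 4 = ((a * e') ^ 4 - 1) - (b ^ 4 - 1) by ring]
    exact dvd_sub h1 (three_dvd_pow_four_sub_one h3b)
  have hU2 : ‖U ^ 2 - 1‖ ≤ 1 / 3 := by
    have hid : U ^ 2 - 1 = ((((a * e') ^ 4 - b ^ 4 : ℤ)) : ℚ_[3]) / (b : ℚ_[3]) ^ 4 * (1 + (a₁ : ℚ_[3]) * z) ^ 2 +
        (a₁ : ℚ_[3]) * z * (2 + (a₁ : ℚ_[3]) * z) := by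
      rw [hU]; push_cast; field_simp; ring
    rw [hid]
    refine (IsUltrametricDist.norm_add_le_max _ _).trans (max_le ?_ ?_)
    · rw [norm_mul, norm_div, norm_pow (b : ℚ_[3]), hbn, one_pow, div_one, norm_pow, h1z, one_pow, mul_one]
      exact (norm_intCast_le_of_pow_dvd (k := 1) (by rw [pow_one]; exact hdvd)).trans (by norm_num)
    · rw [norm_mul]
      have h2z : ‖2 + (a₁ : ℚ_[3]) * z‖ ≤ 1 := by
        refine (IsUltrametricDist.norm_add_le_max _ _).trans (max_le (by rw [h2n]) (ha1z.trans ?_)); linarith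
      calc ‖(a₁ : ℚ_[3]) * z‖ * ‖2 + (a₁ : ℚ_[3]) * z‖ ≤ ρ * 1 := by gcongr
        _ ≤ 1 / 3 := by linarith
  have hlogY := norm_padicLog_sub_le_deepO2 K hUn hU2 hY
  -- `U ≡ u (mod 27)` and the cubic polynomial
  have hun : ‖(u : ℚ_[3])‖ = 1 := norm_intCast_eq_one_of_not_dvd h3u
  have hUu : ‖U - u‖ ≤ 1 / 27 := by
    have hid : U - u = ((((a * e') ^ 2 * (b - a₁ * 3 ^ K * a * e') - u * b ^ 3 : ℤ)) : ℚ_[3]) / (b : ℚ_[3]) ^ 3 := by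
      rw [hU, hz]; push_cast; field_simp; ring
    rw [hid, norm_div, norm_pow, hbn, one_pow, div_one]
    exact (norm_intCast_le_of_pow_dvd (k := 3) (by norm_num; exact hu)).trans (by norm_num)
  have hT0 : ‖1 - U ^ 2‖ ≤ 1 / 3 := by rw [← norm_neg, neg_sub]; exact hU2
  have hT1 : ‖1 - (u : ℚ_[3]) ^ 2‖ ≤ 1 / 3 := by
    rw [show (1 : ℚ_[3]) - (u : ℚ_[3]) ^ 2 = -(((u ^ 2 - 1 : ℤ) : ℚ_[3])) by push_cast; ring, norm_neg]
    exact (norm_intCast_le_of_pow_dvd (k := 1) (by rw [pow_one]; exact h3u2)).trans (by norm_num)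
  have hPoly : ‖((U ^ 2 - 1) - (U ^ 2 - 1) ^ 2 / 2 + (U ^ 2 - 1) ^ 3 / 3) -
      (((u : ℚ_[3]) ^ 2 - 1) - ((u : ℚ_[3]) ^ 2 - 1) ^ 2 / 2 + ((u : ℚ_[3]) ^ 2 - 1) ^ 3 / 3)‖ ≤ 1 / 27 := by
    have hid : ((U ^ 2 - 1) - (U ^ 2 - 1) ^ 2 / 2 + (U ^ 2 - 1) ^ 3 / 3) -
        (((u : ℚ_[3]) ^ 2 - 1) - ((u : ℚ_[3]) ^ 2 - 1) ^ 2 / 2 + ((u : ℚ_[3]) ^ 2 - 1) ^ 3 / 3) =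
        -(((1 - U ^ 2) + (1 - U ^ 2) ^ 2 / 2 + (1 - U ^ 2) ^ 3 / 3) -
          ((1 - (u : ℚ_[3]) ^ 2) + (1 - (u : ℚ_[3]) ^ 2) ^ 2 / 2 + (1 - (u : ℚ_[3]) ^ 2) ^ 3 / 3)) := by ring
    rw [hid, norm_neg]
    refine (norm_cubicPoly_sub_le hT0 hT1).trans ?_
    rw [show (1 - U ^ 2) - (1 - (u : ℚ_[3]) ^ 2) = -((U - u) * (U + u)) by ring, norm_neg, norm_mul]
    have hUu' : ‖U + u‖ ≤ 1 := (IsUltrametricDist.norm_add_le_max _ _).trans (max_le hUn.le hun.le)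
    calc ‖U - u‖ * ‖U + u‖ ≤ 1 / 27 * 1 := by gcongr
      _ = 1 / 27 := mul_one _
  -- `den x = 3^{2K}e'²`
  have hden : x.den = (3 ^ K * e') ^ 2 := by
    have hpos : (0 : ℤ) < ((3 ^ K * e' : ℕ) : ℤ) ^ 2 := by positivity
    have hcop2 : Nat.Coprime a.natAbs ((((3 ^ K * e' : ℕ) : ℤ) ^ 2).natAbs) := by
      rw [Int.natAbs_pow, Int.natAbs_natCast]; exact hcop.pow_right 2
    have h := Rat.den_div_eq_of_coprime hpos hcop2
    have hx' : x = ((a : ℤ) : ℚ) / ((((3 ^ K * e' : ℕ) : ℤ) ^ 2 : ℤ) : ℚ) := by rw [hx]; push_cast; ring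
    rw [← hx'] at h
    exact_mod_cast h
  set Ud : ℚ_[3] := (e' : ℚ_[3]) ^ 2 with hUd
  have hUdn : ‖Ud‖ = 1 := by rw [hUd, norm_pow, he'n, one_pow]
  have hUd2 : ‖Ud ^ 2 - 1‖ ≤ 1 / 3 := by
    rw [show Ud ^ 2 - 1 = ((((e' : ℤ) ^ 4 - 1 : ℤ)) : ℚ_[3]) by rw [hUd]; push_cast; ring]
    exact (norm_intCast_le_of_pow_dvd (k := 1) (by rw [pow_one]; exact three_dvd_pow_four_sub_one h3e')).trans
      (by norm_num)
  have hYd : ‖(((x.den : ℚ)) : ℚ_[3]) - P * Ud‖ ≤ ‖P‖ / 27 := by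
    have : (((x.den : ℚ)) : ℚ_[3]) = P * Ud := by rw [hden, hP, hUd]; push_cast; ring
    rw [this, sub_self, norm_zero]; positivity
  have hlogd := norm_padicLog_sub_le_deepO2 K hUdn hUd2 hYd
  intro h0
  rw [heightFourOneCoord, hwdef] at h0
  have heq : padicLog 3 (((x.den : ℚ)) : ℚ_[3]) = padicLog 3 (C2 * tateSigmaSq q c) := sub_eq_zero.mp h0
  rw [heq] at hlogd
  set PU := (U ^ 2 - 1) - (U ^ 2 - 1) ^ 2 / 2 + (U ^ 2 - 1) ^ 3 / 3 with hPU
  set Pu := ((u : ℚ_[3]) ^ 2 - 1) - ((u : ℚ_[3]) ^ 2 - 1) ^ 2 / 2 + ((u : ℚ_[3]) ^ 2 - 1) ^ 3 / 3 with hPu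
  set PE := (Ud ^ 2 - 1) - (Ud ^ 2 - 1) ^ 2 / 2 + (Ud ^ 2 - 1) ^ 3 / 3 with hPE
  have hdiff : ‖(2 : ℚ_[3])⁻¹ * PE - (2 : ℚ_[3])⁻¹ * Pu‖ ≤ 1 / 27 := by
    have : (2 : ℚ_[3])⁻¹ * PE - (2 : ℚ_[3])⁻¹ * Pu = ((padicLog 3 (C2 * tateSigmaSq q c) - (2 : ℚ_[3])⁻¹ * PU) -
        (padicLog 3 (C2 * tateSigmaSq q c) - (2 : ℚ_[3])⁻¹ * PE)) + (2 : ℚ_[3])⁻¹ * (PU - Pu) := by ring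
    rw [this]
    refine (IsUltrametricDist.norm_add_le_max _ _).trans (max_le ((norm_sub_le_max₄ _ _).trans (max_le hlogY hlogd)) ?_)
    rw [norm_mul, norm_inv_two₄, one_mul]; exact hPoly
  have hid : (2 : ℚ_[3])⁻¹ * PE - (2 : ℚ_[3])⁻¹ * Pu = (12 : ℚ_[3])⁻¹ *
      (((6 * ((e' : ℤ) ^ 4 - 1) - 3 * ((e' : ℤ) ^ 4 - 1) ^ 2 + 2 * ((e' : ℤ) ^ 4 - 1) ^ 3 -
        6 * (u ^ 2 - 1) + 3 * (u ^ 2 - 1) ^ 2 - 2 * (u ^ 2 - 1) ^ 3 : ℤ)) : ℚ_[3]) := by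
    have h2 : (2 : ℚ_[3]) ≠ 0 := by norm_num
    have h3 : (3 : ℚ_[3]) ≠ 0 := by norm_num
    have h12 : (12 : ℚ_[3]) ≠ 0 := by norm_num
    rw [hPE, hPu, hUd]; push_cast; field_simp; ring
  have h12n : ‖(12 : ℚ_[3])⁻¹‖ = 3 := by
    rw [show (12 : ℚ_[3]) = 4 * 3 by norm_num, mul_inv, norm_mul, norm_inv_three₄, norm_inv,
      show (4 : ℚ_[3]) = ((4 : ℤ) : ℚ_[3]) by norm_cast, norm_intCast_eq_one_of_not_dvd (by decide)]; norm_num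
  rw [hid, norm_mul, h12n] at hdiff
  have h81 : ((3 : ℕ) : ℤ) ^ 4 ∣ 6 * ((e' : ℤ) ^ 4 - 1) - 3 * ((e' : ℤ) ^ 4 - 1) ^ 2 + 2 * ((e' : ℤ) ^ 4 - 1) ^ 3 -
      6 * (u ^ 2 - 1) + 3 * (u ^ 2 - 1) ^ 2 - 2 * (u ^ 2 - 1) ^ 3 :=
    (Padic.norm_int_le_pow_iff_dvd (p := 3) _ 4).mp (by
      have : ‖((((6 * ((e' : ℤ) ^ 4 - 1) - 3 * ((e' : ℤ) ^ 4 - 1) ^ 2 + 2 * ((e' : ℤ) ^ 4 - 1) ^ 3 -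
          6 * (u ^ 2 - 1) + 3 * (u ^ 2 - 1) ^ 2 - 2 * (u ^ 2 - 1) ^ 3 : ℤ)) : ℚ_[3]))‖ ≤ 1 / 81 := by linarith
      exact this.trans (by norm_num))
  exact hcert (by simpa using h81)

end Summit.BirchSwinnertonDyer.Rank1Residual.X11b.RegMult.KernelCert
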